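import Summits.BirchSwinnertonDyer.Rank1Residual.ManinAdditive.PsiBrandtDegreeLawAtEightCert
import HarnessLib
import HarnessLib.Audit.Tags

/-!
# The depth-four ψ-twisted Hurwitz Brandt module at 2 and the degree law at 32 ∥ N (cell bsd-f2-manin, desc g20, MEMO-desc §45)

TYPER NOTE (typer g20, T-desc-38).  SOURCE = HOME/desc/g20/lean/Sketch-desc-g20.lean sha16 3be55920bca2bcb5 (309 l.; desc: farm rc 0 · 0 err ·
0 warn · 0 s∗rry, 40.6 s, check-g20.json 39e4b98efd7cffee; BC7 ProbeG20a/b 5/5 CLEAN), §1–§3 VERBATIM except: this note; the import is the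
landed sibling `…PsiBrandtDegreeLawAtEightCert` (p716074; it imports only `…PsiBrandtDegreeLawAtEight`, so the cone is unchanged and
ROUTE-INDEPENDENT) so that desc's local restatement of `PsiBrandt.isPrimitiveInt_of_apply_eq_one` is replaced by the tree lemma BY NAME (gate
dedup); E-desc-144 `DiscriminantValuationAtThirtyTwo` is a PLAIN `def … : Prop` (desc files it as a KNOWN table row, [Papadopoulos1993,
Table IV]; same treatment as E-desc-133 at `8 ∥ N` / E-desc-137 at `16 ∥ N`; its `_holds` by the f₂ = 5 Tate-table walk is ask T-desc-38b for a
prover).  `@[conjecture]` on the cell rows **E-desc-140 `Psi32BrandtNewLineAtThirtyTwoPrime`** (JL multiplicity one at ψ-depth four; support),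
**E-desc-141 `Psi32BrandtDegreeLawAtThirtyTwoPrime`** (THE LAW `deg φ = 2^κ·H(g)`), **E-desc-142 `Psi32BrandtRootNumberLawAtThirtyTwoPrime`**,
**E-desc-143 `Psi32BrandtTwistTypeLawAtThirtyTwoPrime`** (dictionary laws).  BC5 = HOME/desc/g20/ (SHA16SUMS.desc.g20): CENSUS-32.md
feb0cbe57e8387e5 (1277/1278 optimal curves `32 ∥ N < 10⁴`, sole exception 32a1 = level one, outside the prime-cofactor rows), CENSUS-32-full.md
18558aae2bfb7262 (kit j330930: 7518/7519 to `5·10⁴`, out-of-sample 6241/6241; E-142/143 7519/7519), second engine PARI trace formula 95/95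
(TR32-j331106.txt c1f043256820b55a), E-144 on all 117 608 ecdata curves with `32 ∥ N`.  FALSIFIER: one optimal curve of conductor `32p`
with `deg φ ≠ 2^κ·H(g)` (D-desc-34 extends to `5·10⁵`).  Refuter verdict R-desc-36 pending at landing time.  No instances (desc's decidability
goes through the explicit `InOnePlusTwoO.decidable`), no notation.  NOT IN PRINT as stated (nearest: [Pizer1980] Thm 3.13 / [Gross1987Heights] /
[PollackWeston2011] Thm 6.8 at squarefree level — the ψ-twisted depth-four module and the κ-table are the cell's, MEMO-desc §45).


Rows E-desc-140 `Psi32BrandtNewLineAtThirtyTwoPrime` (JL multiplicity one, support), E-desc-141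
`Psi32BrandtDegreeLawAtThirtyTwoPrime` (THE LAW), E-desc-142 `Psi32BrandtRootNumberLawAtThirtyTwoPrime` and E-desc-143
`Psi32BrandtTwistTypeLawAtThirtyTwoPrime` (DICTIONARY LAWS: the `V₄ = Stab(ψ)`-character of the JL line is
`(w₂(E)w₂(E⊗χ₋₄), −w₂(E⊗χ₋₄), −w₂(E))` on `(j, i+k, i−k)`), E-desc-144 `DiscriminantValuationAtThirtyTwo` (E-facing
support: `32 ∥ N ⟹ (v₂Δ, v₂c₄) ∈ {(6,4),(9,4),(12,6),(12,7)}` = Kodaira `III, I₀*, I₃*, III*`), kernel certificates `g96a`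
(`III`), `g352a` (`III*`), `g416a` (`I₀*`), `g928a` (`I₃*`).  Nothing is asserted: the rows are `def … : Prop` tagged
`@[conjecture]`; the certificates are `decide +kernel` evaluations of the computable model of `HurwitzBrandtTwoEisenstein.lean`
(`DQuat`, `hurwitzOfNorm`, `act`) and of `PsiBrandtDegreeLawAtEight.lean` (`InOnePlusTwoO`, `IsPrimitiveInt`, `psiHeight`).

THE MODULE (desc g20; engine HOME/desc/g20/b32/brandt32.py).  `O` = Hurwitz order of `B_{2,∞}`, `𝔓 = (1+i)O`.  A weight-2 newform
with `32 ∥ N` (`f₂ = 5`) is SUPERCUSPIDAL at 2 of conductor exponent 5 with trivial central character: `π₂ = Ind_K θ`,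
`K ∈ {ℚ₂(i), ℚ₂(√3)}` (`d_K = 2`), `a(θ) = 3` (the `d_K = 3` fields and the principal series are excluded by the central
character), FOUR types in all (`K`, and `θ ↦ θ·η_K`, `η` unramified quadratic).  Under Jacquet–Langlands they are the four
6-dimensional irreducible representations of `G := D₂^×/ℚ₂^×(1+𝔓⁴)` (`|G| = 192`, `Σ 6² = 144 = 192 − |D₂^×/ℚ₂^×(1+𝔓³)|`).
Put `H := (1+2O₂)/±(1+4O₂) ≅ O/2O/𝔽₂ ≅ (ℤ/2)³` (normal in `G`) and let `ψ` be a character of `O/2O` trivial on `1` and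
NON-trivial on `𝔓/2O` (six such, one `G`-orbit; this file fixes `ψ(a) = (−1)^{n₁}` for `a = n₀ + n₁ i + n₂ j + n₃ ω`,
`ω = (−1+i+j+k)/2`, i.e. `ψ(γ) = (−1)^{(B−D)/4}` for `γ = (A+Bi+Cj+Dk)/2 ≡ 1 (mod 2O)` in doubled coordinates); every
conductor-5 type `ρ` has `ρ|_H ∋ ψ` exactly ONCE.  `Γ̄ := ⟨O^×, 1+i⟩/⟨±1, 2⟩` (order 24) satisfies `G = Γ̄·H` uniquely, so
for the level `U = ℚ₂^×(1+𝔓⁴) × K₀(M)` (`M` odd) the `ψ`-isotypic integral automorphic forms on `D^×(ℚ)\D^×(𝔸_f)/U`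
are identified with ALL functions `g : ℙ¹(ℤ/M) → ℤ` (`g(x) = F(1, x)`), every class having trivial stabiliser (UNIFORM measure,
height `H(g) = Σ_x g(x)²`), with
  `(T_ℓ g)(x) = Σ_{O^×γ : Nrd γ = ℓ} ψ(γ) g(γ·x)`   (`γ` the representative `≡ 1 (mod 2O)`, unique up to sign; `ℓ` odd, `ℓ ∤ M`),
the SIGNED Hurwitz Brandt matrix (`psi32HeckeTwice` below is `2T_ℓ`: both signs of `γ` are summed).  JL dimension identity
(an identity of the genus formula, and checked at every odd `M ≤ 1561`): `rk 𝓜_ψ(M) = |ℙ¹(ℤ/M)| = ψ(M) = g₀(32M) − 2g₀(16M) + g₀(8M)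
= dim S₂(Γ₀(32M))^{f₂ = 5}`.  `Stab_Γ̄(ψ) = {1, j, i+k, i−k} ≅ V₄` acts on `𝓜_ψ(M)` (`R_s g = g ∘ s⁻¹`) commuting with the
`T_ℓ` and the Atkin–Lehner involutions; its character `λ_E` on the `E`-line tells WHICH of the four types `π_{E,2}` is.

THE LAW (E-desc-141; census HOME/desc/g20/b32/: CENSUS-32.md + B32-rows tables = ALL optimal curves with `32 ∥ N < 10⁴`
(1278 curves, 152 levels, `M` prime or not) and the kit census to `N < 5·10⁴` (7519 curves, 645 levels; job id in the memo)):
  `deg φ_E = 2^{κ(E)} · H(g_E)`,  `κ = 1, 2, 2, 3` for Kodaira `III, I₀*, I₃*, III*` at 2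
(equivalently `(v₂Δ_min, v₂c₄) = (6,4), (9,4), (12,6), (12,7)` — the only values at `32 ∥ N`, E-desc-144), with the SINGLE
exception `32a1` (`M = 1`, `I₃*`, `deg φ = H = 1`) in the whole range; in particular `ord_ℓ deg φ = ord_ℓ H(g_E)` for every odd
prime `ℓ` and `2 ∣ deg φ` (Calegari–Emerton parity is the case `κ ≥ 1`).  No Tamagawa number and no centring bit enters
(contrast `8 ∥ N`, E-desc-132/135): `c₂ ∈ {1, 2}` varies freely inside `I₀*` and `c₂ ∈ {2, 4}` inside `I₃*` at constant `κ = 2`.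

DICTIONARY (E-desc-142/143; 1278/1278): `λ_E(i−k) = −w₂(E)`, `λ_E(i+k) = −w₂(E ⊗ χ₋₄)`, `λ_E(j) = w₂(E)·w₂(E ⊗ χ₋₄)`
(`w₂` = local root number at 2 `= w(E)·a_p(E)` at `N = 32p`; the `χ₋₄`-twist preserves the level `32M`), and `λ_E(j) = +1`
iff `(III ∧ 2⁸ ∣ c₆) ∨ (I₀* ∧ Δ/2⁹ ≡ 1 (4)) ∨ (III* ∧ c₄/2⁷ ≡ 1 (4)) ∨ (I₃* ∧ 2¹¹ ∣ c₆)` — conjecturally `λ_E(j) = +1 ⟺ K = ℚ₂(i)`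
(the `χ₋₄`-rigid types).

bears_on: stmt-BirchSwinnertonDyer-22967 (C2) via the exact 2-adic valuation of deg φ at 32 ∥ N (input of the ČNS inequality
`ord₂ c_E ≤ ord₂ deg φ + …`).  PARTITION 0 · beyond-print theorem: no.  BSD is not proved by this; Manin's conjecture is not
proved by this; C2/C3 OPEN.
-/

open scoped MatrixGroups ModularForm

open CongruenceSubgroup WeierstrassCurve Literature.NumberTheory.EllipticCurves.ModularForms
open Summit.BirchSwinnertonDyer.Rank1Residual.ManinAdditive.HurwitzBrandt
open Summit.BirchSwinnertonDyer.Rank1Residual.ManinAdditive.PsiBrandt (InOnePlusTwoO InOnePlusTwoO.decidable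
  IsPrimitiveInt psiHeight isPrimitiveInt_of_apply_eq_one)

namespace Summit.BirchSwinnertonDyer.Rank1Residual.ManinAdditive.Psi32Brandt

/-! ### §1. The depth-four ψ-twisted Hurwitz Brandt module at prime level `M = p` (computable model) -/

/-- the sign `ψ(γ) = (−1)^{(B−D)/4}` of a doubled Hurwitz quaternion `γ = (A, B, C, D) ≡ 1 (mod 2O)` (then `B ≡ D (mod 4)`):
the character of `(1+2O₂)/±(1+4O₂) ≅ (O/2O)/𝔽₂` given by `a = n₀ + n₁i + n₂j + n₃ω ↦ (−1)^{n₁}`, non-trivial on `𝔓/2O`; only ever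
applied to elements `≡ 1 (mod 2O)`, on which it is multiplicative and even (`ψ(−γ) = ψ(γ)`). [folklore] -/
def psi32Sign (γ : DQuat) : ℤ := if (γ.2.1 - γ.2.2.2) % 8 = 0 then 1 else -1

/-- TWICE THE SIGNED HECKE OPERATOR `T_ℓ` on point functions `g : ℙ¹(𝔽_p) → ℤ`:
`(2T_ℓ g)(x) = Σ_{γ ∈ O, Nrd γ = ℓ, γ ≡ 1 (mod 2O)} ψ(γ) g(γ·x)` (`2(ℓ+1)` terms, `±` one per left unit coset, equal signs;
`ℓ` an odd prime `≠ p`). [folklore] -/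
def psi32HeckeTwice (p ℓ : ℕ) (g : Fin (p + 1) → ℤ) (x : Fin (p + 1)) : ℤ :=
  (((hurwitzOfNorm ℓ).filter fun γ => @decide (InOnePlusTwoO γ) (InOnePlusTwoO.decidable γ)).map
    fun γ => psi32Sign γ * g (act p γ x)).sum

/-- `g` is a SIGNED HECKE EIGENFUNCTION with eigenvalues `a = (a_ℓ)`: `2T_ℓ g = 2a_ℓ · g` for every odd prime `ℓ ≠ p`.
[folklore] -/
def IsPsi32HeckeEigen (p : ℕ) (g : Fin (p + 1) → ℤ) (a : ℕ → ℤ) : Prop :=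
  ∀ ℓ : ℕ, ℓ.Prime → ℓ ≠ 2 → ℓ ≠ p → ∀ x : Fin (p + 1), psi32HeckeTwice p ℓ g x = 2 * a ℓ * g x

/-- `j` in doubled coordinates: with `1` it is the part of `Stab_Γ̄(ψ) ≅ V₄` inside `O^×/±1`. [folklore] -/
def jQuat : DQuat := (0, 0, 2, 0)

/-- `i + k` (reduced norm 2) in doubled coordinates: an element of `Stab_Γ̄(ψ)`, of order 2 in `Γ̄` (`(i+k)² = −2`). [folklore] -/
def iPlusK : DQuat := (0, 2, 0, 2)

/-- `i − k` (reduced norm 2) in doubled coordinates: `= (i+k)·j` in `Γ̄`, the third involution of `Stab_Γ̄(ψ)`. [folklore] -/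
def iMinusK : DQuat := (0, 2, 0, -2)

/-- the BRANDT EXPONENT `κ(E) ∈ {1, 2, 3}` at `32 ∥ N`, keyed to the (globally minimal) model: `v₂(Δ) = 6 ↦ 1` (`III`),
`v₂(Δ) = 12 ∧ v₂(c₄) = 7 ↦ 3` (`III*`), anything else (`v₂(Δ) = 9`, `I₀*`; `v₂(Δ) = 12 ∧ v₂(c₄) = 6`, `I₃*`) `↦ 2`. [folklore] -/
noncomputable def brandtExponentAtThirtyTwo (W : WeierstrassCurve ℚ) : ℕ :=
  if padicValRat 2 W.Δ = 6 then 1 else if padicValRat 2 W.Δ = 12 ∧ padicValRat 2 W.c₄ = 7 then 3 else 2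

open scoped Classical in
/-- the TWIST-TYPE SIGN `λ_j(E) ∈ {±1}` at `32 ∥ N` read off the minimal model: `+1` iff
`(v₂Δ = 6 ∧ 2⁸ ∣ c₆)` (`III` with `v₂c₆ ≥ 8`) `∨ (Δ ∈ 2⁹(1 + 4ℤ))` (`I₀*`) `∨ (c₄ ∈ 2⁷(1 + 4ℤ))` (`III*`)
`∨ (v₂Δ = 12 ∧ v₂c₄ = 6 ∧ 2¹¹ ∣ c₆)` (`I₃*` with `v₂c₆ ≥ 11`); conjecturally `+1 ⟺ π_{E,2}` is induced from `ℚ₂(i)`. [folklore] -/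
noncomputable def twistTypeSignAtThirtyTwo (W : WeierstrassCurve ℚ) : ℤ :=
  if (padicValRat 2 W.Δ = 6 ∧ ∃ k : ℤ, W.c₆ = 2 ^ 8 * k) ∨ (∃ k : ℤ, W.Δ = 2 ^ 9 * (4 * k + 1)) ∨
      (∃ k : ℤ, W.c₄ = 2 ^ 7 * (4 * k + 1)) ∨ (padicValRat 2 W.Δ = 12 ∧ padicValRat 2 W.c₄ = 6 ∧ ∃ k : ℤ, W.c₆ = 2 ^ 11 * k)
  then 1 else -1

/-! ### §2. Rows -/

/-- **Row E-desc-144 `DiscriminantValuationAtThirtyTwo` (E-facing SUPPORT; nothing asserted — provable by the tree's Tate-algorithm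
table walk at 2 exactly as `…conductorNorm_eq_three` (p712586) was; census: all 1278 optimal curves with `32 ∥ N < 10⁴` have
`(Kodaira, v₂Δ, v₂c₄, v₂c₆, c₂) ∈ {(III,6,4,≥7,2), (I₀*,9,4,6,1|2), (I₃*,12,6,≥10,2|4), (III*,12,7,9,2)}`, re-checked to `5·10⁴` by the kit
census).**  `32 ∥ N ⟹ (v₂Δ_min, v₂c₄) ∈ {(6,4), (9,4), (12,6), (12,7)}`.
Typed SUPPORT row IN PRINT (plain `def`, nothing asserted; typer: not tagged `@[conjecture]` because it is a table row of
[Papadopoulos1993] — exactly as E-desc-133 `DiscriminantValuationAtEight` at `8 ∥ N`; its `_holds` is ask T-desc-38b).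
[cite: Papadopoulos1993, Table IV (p = 2): the triples (Kodaira type, v(Δ), f) with f = 5] -/
def DiscriminantValuationAtThirtyTwo : Prop :=
  ∀ (W : WeierstrassCurve ℚ) [W.IsElliptic] [W.IsGloballyMinimal],
    padicValNat 2 (W.conductorNorm ℤ) = 5 →
    (padicValRat 2 W.Δ = 6 ∧ padicValRat 2 W.c₄ = 4) ∨ (padicValRat 2 W.Δ = 9 ∧ padicValRat 2 W.c₄ = 4) ∨
      (padicValRat 2 W.Δ = 12 ∧ padicValRat 2 W.c₄ = 6) ∨ (padicValRat 2 W.Δ = 12 ∧ padicValRat 2 W.c₄ = 7)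

/-- **Row E-desc-140 `Psi32BrandtNewLineAtThirtyTwoPrime` (MULTIPLICITY ONE at ψ-depth four; construction statement for
E-desc-141; nothing asserted).**  For every elliptic curve of conductor `32p`, `p` an odd prime, the `(a_ℓ(E))`-eigenfunctions of
the signed Brandt module `𝓜_ψ(p) = ℤ^{ℙ¹(𝔽_p)}` form a free `ℤ`-module of rank one: a primitive signed-Hecke-eigen `g` EXISTS and is
unique up to sign (Jacquet–Langlands for the conductor-32 supercuspidals at 2 — multiplicity one of `ψ` in each of the four
6-dimensional types — + newform theory; census: a rank-1 eigenline at 1278/1278 optimal curves `32 ∥ N < 10⁴` with 12 Hecke primes,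
JL dimension identity at every level).
[cite: Pizer1980, Thm. 3.13 (shape: Brandt matrices of 2-adically non-Eichler level realise new spaces — the ψ-twisted depth-four form is the cell's, MEMO-desc §45, NOT in print as far as searched)] -/
@[conjecture]
def Psi32BrandtNewLineAtThirtyTwoPrime : Prop :=
  ∀ (p : ℕ), p.Prime → p ≠ 2 →
  ∀ (W : WeierstrassCurve ℚ) [W.IsElliptic], W.conductorNorm ℤ = 32 * p →
    (∃ g : Fin (p + 1) → ℤ, IsPrimitiveInt p g ∧ IsPsi32HeckeEigen p g fun n => W.LFunction n) ∧
    ∀ g g' : Fin (p + 1) → ℤ,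
      IsPrimitiveInt p g → IsPsi32HeckeEigen p g (fun n => W.LFunction n) →
      IsPrimitiveInt p g' → IsPsi32HeckeEigen p g' (fun n => W.LFunction n) →
      (g' = g ∨ g' = -g)

/-- **Row E-desc-141 `Psi32BrandtDegreeLawAtThirtyTwoPrime` — THE ψ-BRANDT DEGREE LAW at `32 ∥ N`, prime cofactor `M = p`
(LAW; cell bsd-f2-manin, desc g20, MEMO-desc §45; nothing asserted).**  For the `X₀(32p)`-optimal curve `E` (lattice clause +
minimal-degree clause) and any primitive signed Hecke eigenfunction `g` for `(a_ℓ(E))`: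
  `deg φ_E = 2^{κ(E)} · H(g)`,  `κ(E) = brandtExponentAtThirtyTwo E ∈ {1, 2, 3}` (`III ↦ 1`, `I₀*, I₃* ↦ 2`, `III* ↦ 3`).
Census (BC5 witness): ALL 1278 optimal curves with `32 ∥ N < 10⁴` (152 levels, `M` prime or not): `deg φ / H = 2` on the 643 `III`,
`4` on the 220 `I₀*` (110 with `c₂ = 1`, 110 with `c₂ = 2`) and on the 100 `I₃*` with `N > 32` (41 | 59 with `c₂ = 2 | 4`), `8` on the 314
`III*`; the ONE exception in range is `32a1` (`M = 1`: `deg φ = H = 1`), outside this prime-cofactor row; kit census to `5·10⁴` in the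
memo.  Why it might fail: a congruence between `f_E` and another `f₂ = 5` newform of level `32p` invisible in `X₀(32p)` (the additive
Ribet–Takahashi comparison at a WILD supercuspidal prime is OPEN), which would show as an odd prime in `deg φ / H`; or an `I₀*`/`I₃*`
distinction the range `N < 5·10⁴` does not contain.
[cite: PollackWeston2011, Thm. 6.8 with Prop. 6.7 (tree `PollackWeston2011.thm_6_8_ellipticCurve`: squarefree level, ord_p δ_f = ord_p ξ_f + Σ t_f(q) — the shape whose wild additive analogue at 2 this row is; NOT in print)]
[cite: Gross1987Heights, §§1–4 (heights on Brandt modules at prime level, trivial character)] -/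
@[conjecture]
def Psi32BrandtDegreeLawAtThirtyTwoPrime : Prop :=
  ∀ (p : ℕ), p.Prime → p ≠ 2 →
  ∀ (W : WeierstrassCurve ℚ) [W.IsElliptic] [W.IsGloballyMinimal] [NeZero (W.conductorNorm ℤ)]
    (D : ModularParametrizationData W (W.conductorNorm ℤ)),
    W.conductorNorm ℤ = 32 * p →
    (∀ z ∈ D.L.lattice, ∃ w ∈ periodLattice D.f, z = D.c * w) →
    (∀ (W' : WeierstrassCurve ℚ) [W'.IsElliptic]
        (D' : ModularParametrizationData W' (W.conductorNorm ℤ)),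
        D'.f = D.f → D.modularDegree ≤ D'.modularDegree) →
  ∀ g : Fin (p + 1) → ℤ,
    IsPrimitiveInt p g → IsPsi32HeckeEigen p g (fun n => W.LFunction n) →
    (D.modularDegree : ℤ) = 2 ^ (brandtExponentAtThirtyTwo W) * psiHeight p g

/-- the prime-to-2 EDGE of the law: for an odd prime `ℓ`, `ord_ℓ deg φ = ord_ℓ H(g)` (the Ribet–Takahashi content at `ℓ ≥ 3`). -/
theorem padicValInt_modularDegree_eq_of_psi32BrandtDegreeLaw (h : Psi32BrandtDegreeLawAtThirtyTwoPrime)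
    (p : ℕ) (hp : p.Prime) (hp2 : p ≠ 2)
    (W : WeierstrassCurve ℚ) [W.IsElliptic] [W.IsGloballyMinimal] [NeZero (W.conductorNorm ℤ)]
    (D : ModularParametrizationData W (W.conductorNorm ℤ)) (hN : W.conductorNorm ℤ = 32 * p)
    (hΛ : ∀ z ∈ D.L.lattice, ∃ w ∈ periodLattice D.f, z = D.c * w)
    (hmin : ∀ (W' : WeierstrassCurve ℚ) [W'.IsElliptic] (D' : ModularParametrizationData W' (W.conductorNorm ℤ)),
        D'.f = D.f → D.modularDegree ≤ D'.modularDegree)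
    (g : Fin (p + 1) → ℤ) (hprim : IsPrimitiveInt p g) (heig : IsPsi32HeckeEigen p g fun n => W.LFunction n)
    (ℓ : ℕ) (hℓ : ℓ.Prime) (hℓ2 : ℓ ≠ 2) :
    padicValInt ℓ (D.modularDegree : ℤ) = padicValInt ℓ (psiHeight p g) := by
  have key := h p hp hp2 W D hN hΛ hmin g hprim heig
  haveI : Fact ℓ.Prime := ⟨hℓ⟩
  have h2n : padicValNat ℓ 2 = 0 := by
    rw [padicValNat.eq_zero_iff]
    refine Or.inr (Or.inr ?_)
    intro hd
    exact hℓ2 ((Nat.prime_dvd_prime_iff_eq hℓ Nat.prime_two).1 hd)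
  have hpow : ∀ n : ℕ, padicValInt ℓ ((2 : ℤ) ^ n) = 0 := by
    intro n
    simp [padicValInt, Int.natAbs_pow, padicValNat.pow, h2n]
  by_cases hH : psiHeight p g = 0
  · rw [key, hH, mul_zero]
  · rw [key, padicValInt.mul (pow_ne_zero _ (by norm_num)) hH, hpow, zero_add]

/-- the PARITY EDGE of the law: `2 ∣ deg φ_E` for every optimal `E` with `N = 32p` (in print: Calegari–Emerton's parity theorem
covers it; here it is the inequality `κ ≥ 1`). -/
theorem two_dvd_modularDegree_of_psi32BrandtDegreeLaw (h : Psi32BrandtDegreeLawAtThirtyTwoPrime)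
    (p : ℕ) (hp : p.Prime) (hp2 : p ≠ 2)
    (W : WeierstrassCurve ℚ) [W.IsElliptic] [W.IsGloballyMinimal] [NeZero (W.conductorNorm ℤ)]
    (D : ModularParametrizationData W (W.conductorNorm ℤ)) (hN : W.conductorNorm ℤ = 32 * p)
    (hΛ : ∀ z ∈ D.L.lattice, ∃ w ∈ periodLattice D.f, z = D.c * w)
    (hmin : ∀ (W' : WeierstrassCurve ℚ) [W'.IsElliptic] (D' : ModularParametrizationData W' (W.conductorNorm ℤ)),
        D'.f = D.f → D.modularDegree ≤ D'.modularDegree)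
    (g : Fin (p + 1) → ℤ) (hprim : IsPrimitiveInt p g) (heig : IsPsi32HeckeEigen p g fun n => W.LFunction n) :
    (2 : ℤ) ∣ (D.modularDegree : ℤ) := by
  have key := h p hp hp2 W D hN hΛ hmin g hprim heig
  have hκ : 1 ≤ brandtExponentAtThirtyTwo W := by
    unfold brandtExponentAtThirtyTwo; split_ifs <;> omega
  rw [key]
  exact Dvd.dvd.mul_right (dvd_pow_self 2 (by omega)) _

/-- **Row E-desc-142 `Psi32BrandtRootNumberLawAtThirtyTwoPrime` — THE `(i−k)`-INVOLUTION READS THE LOCAL ROOT NUMBER AT 2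
(DICTIONARY LAW; cell bsd-f2-manin, desc g20, MEMO-desc §45; nothing asserted).**  For `N = 32p` and any primitive signed Hecke
eigenfunction `g` for `(a_ℓ(E))`: `g((i−k)·x) = −w(E)·a_p(E)·g(x)` for all `x ∈ ℙ¹(𝔽_p)`, i.e. `λ_E(i−k) = −w₂(E)` with `w₂(E) =
w(E)·a_p(E)` the local root number at 2 (`a_p(E) = −ε_p`, multiplicative reduction at `p`).  Census (BC5 witness, `w(E)` read as
`(−1)^{rank}` from Cremona's table): `λ_E(i−k) = (−1)^{rank} ∏_{q ∣ M} ε_q` for ALL 1278 optimal curves with `32 ∥ N < 10⁴` (any odd `M`,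
the `ε_q` being the Brandt-side Atkin–Lehner signs), 0 exceptions.  Why it might fail: only through a sign-convention slip between
`i − k` and `W₃₂` (a universal sign would show at once: it does not, `λ(i−k) = −1` at 96a1 and `+1` at 96b1) or a parity failure in
rank ≥ 2 read through `(−1)^{rank}` (the statement itself uses `W.rootNumber`).
[cite: PollackWeston2011, §2 (Atkin–Lehner operators on definite quaternion algebras vs. newforms; squarefree level)]
[cite: Gross1987Heights, §§1–4] -/
@[conjecture]
def Psi32BrandtRootNumberLawAtThirtyTwoPrime : Prop :=
  ∀ (p : ℕ), p.Prime → p ≠ 2 →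
  ∀ (W : WeierstrassCurve ℚ) [W.IsElliptic], W.conductorNorm ℤ = 32 * p →
  ∀ g : Fin (p + 1) → ℤ,
    IsPrimitiveInt p g → IsPsi32HeckeEigen p g (fun n => W.LFunction n) →
    ∀ x : Fin (p + 1), g (act p iMinusK x) = -(W.rootNumber * W.LFunction p) * g x

/-- **Row E-desc-143 `Psi32BrandtTwistTypeLawAtThirtyTwoPrime` — THE `j`-INVOLUTION READS THE `χ₋₄`-TWIST TYPE
(DICTIONARY LAW; cell bsd-f2-manin, desc g20, MEMO-desc §45; nothing asserted).**  For `N = 32p`, the GLOBALLY MINIMAL model `W`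
and any primitive signed Hecke eigenfunction `g` for `(a_ℓ(E))`: `g(j·x) = λ_j(E)·g(x)` with `λ_j(E) = twistTypeSignAtThirtyTwo W`,
i.e. `+1` iff `(III ∧ 2⁸ ∣ c₆) ∨ (I₀* ∧ Δ/2⁹ ≡ 1 (4)) ∨ (III* ∧ c₄/2⁷ ≡ 1 (4)) ∨ (I₃* ∧ 2¹¹ ∣ c₆)`.  Census (BC5 witness): 1278/1278
optimal curves `32 ∥ N < 10⁴` (any odd `M`); on the same range `λ_j(E) = w₂(E)·w₂(E ⊗ χ₋₄)` (1278/1278, the twist partner always of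
the same level `32M`; the 28 CM curves are self-partners with `λ_j = +1`).  Why it might fail: the residue description is fitted on
`N < 10⁴` (four clauses, one per Kodaira symbol) — a fifth congruence class of `(c₄, c₆, Δ)` at `32 ∥ N` beyond the range would
break the `iff` while leaving `λ_j = w₂(E)w₂(E⊗χ₋₄)` intact.
[cite: Gross1987Heights, §§1–4] [cite: PollackWeston2011, §2] -/
@[conjecture]
def Psi32BrandtTwistTypeLawAtThirtyTwoPrime : Prop :=
  ∀ (p : ℕ), p.Prime → p ≠ 2 →
  ∀ (W : WeierstrassCurve ℚ) [W.IsElliptic] [W.IsGloballyMinimal], W.conductorNorm ℤ = 32 * p →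
  ∀ g : Fin (p + 1) → ℤ,
    IsPrimitiveInt p g → IsPsi32HeckeEigen p g (fun n => W.LFunction n) →
    ∀ x : Fin (p + 1), g (act p jQuat x) = twistTypeSignAtThirtyTwo W * g x

/-! ### §3. Kernel certificates: 96a1 (`III`), 352a1 (`III*`), 416a1 (`I₀*`), 928a1 (`I₃*`) -/

/-- the ψ-newform of **`96a1`** (`p = 3`, `(a,b) = (1,1)`, Kodaira `III` (`v₂Δ = 6`, `v₂c₆ = 7`), `c₂ = 2`, rank 0, `deg φ = 4`;
`a₅ = 2`, `a₇ = −4`). -/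
def g96a : Fin 4 → ℤ := ![0, 1, -1, 0]

/-- `2T₅ g = 2·2·g`, `2T₇ g = 2·(−4)·g`, `H(g) = 2` (so `deg φ = 4 = 2¹·H`: `κ(III) = 1`), `g 1 = 1`, and the `V₄`-signs
`λ(j) = −1` (`v₂c₆ = 7`), `λ(i−k) = −1 = −w₂` (`w = +1`, `a₃ = +1`) (kernel certificate). -/
theorem g96a_certificate :
    (∀ x : Fin 4, psi32HeckeTwice 3 5 g96a x = 2 * 2 * g96a x) ∧ (∀ x : Fin 4, psi32HeckeTwice 3 7 g96a x = 2 * (-4) * g96a x) ∧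
      psiHeight 3 g96a = 2 ∧ g96a 1 = 1 ∧ (∀ x : Fin 4, g96a (act 3 jQuat x) = -g96a x) ∧
      (∀ x : Fin 4, g96a (act 3 iMinusK x) = -g96a x) := by
  refine ⟨by decide +kernel, by decide +kernel, by decide +kernel, by decide +kernel, by decide +kernel, by decide +kernel⟩

/-- the ψ-newform of **`352a1`** (`p = 11`, `(a,b) = (1,3)`, Kodaira `III*` (`v₂Δ = 12`, `v₂c₄ = 7`, `c₄/2⁷ ≡ 1 (4)`), `c₂ = 2`,
rank 0, `deg φ = 32`; `a₃ = a₅ = 1`). -/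
def g352a : Fin 12 → ℤ := ![1, 0, -1, 0, 0, -1, 0, 0, 0, 0, 0, 1]

/-- `2T₃ g = 2·1·g`, `2T₅ g = 2·1·g`, `H(g) = 4` (so `deg φ = 32 = 2³·H`: `κ(III*) = 3`), `g 0 = 1`, `λ(j) = +1`, `λ(i−k) = −1 = −w₂`
(`w = +1`, `a₁₁ = +1`) (kernel certificate). -/
theorem g352a_certificate :
    (∀ x : Fin 12, psi32HeckeTwice 11 3 g352a x = 2 * 1 * g352a x) ∧ (∀ x : Fin 12, psi32HeckeTwice 11 5 g352a x = 2 * 1 * g352a x) ∧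
      psiHeight 11 g352a = 4 ∧ g352a 0 = 1 ∧ (∀ x : Fin 12, g352a (act 11 jQuat x) = g352a x) ∧
      (∀ x : Fin 12, g352a (act 11 iMinusK x) = -g352a x) := by
  refine ⟨by decide +kernel, by decide +kernel, by decide +kernel, by decide +kernel, by decide +kernel, by decide +kernel⟩

/-- the ψ-newform of **`416a1`** (`p = 13`, `(a,b) = (0,5)`, Kodaira `I₀*` (`v₂Δ = 9`, `Δ/2⁹ ≡ 3 (4)`), `c₂ = 1`, rank 0,
`deg φ = 16`; `a₃ = a₅ = 1`). -/
def g416a : Fin 14 → ℤ := ![0, 0, 0, 0, 0, 0, 0, 1, 0, 1, -1, -1, 0, 0]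

/-- `2T₃ g = 2·1·g`, `2T₅ g = 2·1·g`, `H(g) = 4` (so `deg φ = 16 = 2²·H`: `κ(I₀*) = 2` although `c₂ = 1`), `g 7 = 1`, `λ(j) = −1`,
`λ(i−k) = −1 = −w₂` (`w = +1`, `a₁₃ = +1`) (kernel certificate). -/
theorem g416a_certificate :
    (∀ x : Fin 14, psi32HeckeTwice 13 3 g416a x = 2 * 1 * g416a x) ∧ (∀ x : Fin 14, psi32HeckeTwice 13 5 g416a x = 2 * 1 * g416a x) ∧
      psiHeight 13 g416a = 4 ∧ g416a 7 = 1 ∧ (∀ x : Fin 14, g416a (act 13 jQuat x) = -g416a x) ∧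
      (∀ x : Fin 14, g416a (act 13 iMinusK x) = -g416a x) := by
  refine ⟨by decide +kernel, by decide +kernel, by decide +kernel, by decide +kernel, by decide +kernel, by decide +kernel⟩

/-- the ψ-newform of **`928a1`** (`p = 29`, `(a,b) = (0,12)`, Kodaira `I₃*` (`v₂Δ = 12`, `v₂c₄ = 6`, `v₂c₆ = 11`), `c₂ = 4`, rank 1,
`deg φ = 64`; `a₃ = 1`, `a₅ = −1`). -/
def g928a : Fin 30 → ℤ :=
  ![0, 0, 1, -1, -1, 0, 0, -1, 1, 0, 1, 1, 0, 0, 1, -1, 0, 0, 1, -1, 0, 1, -1, 0, 0, -1, 1, -1, 0, 0]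

/-- `2T₃ g = 2·1·g`, `2T₅ g = 2·(−1)·g`, `H(g) = 16` (so `deg φ = 64 = 2²·H`: `κ(I₃*) = 2`), `g 2 = 1`, `λ(j) = +1` (`v₂c₆ = 11`),
`λ(i−k) = −1 = −w₂` (`w = −1`, `a₂₉ = −1`) (kernel certificate). -/
theorem g928a_certificate :
    (∀ x : Fin 30, psi32HeckeTwice 29 3 g928a x = 2 * 1 * g928a x) ∧ (∀ x : Fin 30, psi32HeckeTwice 29 5 g928a x = 2 * (-1) * g928a x) ∧
      psiHeight 29 g928a = 16 ∧ g928a 2 = 1 ∧ (∀ x : Fin 30, g928a (act 29 jQuat x) = g928a x) ∧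
      (∀ x : Fin 30, g928a (act 29 iMinusK x) = -g928a x) := by
  refine ⟨by decide +kernel, by decide +kernel, by decide +kernel, by decide +kernel, by decide +kernel, by decide +kernel⟩

/-- the four certified point functions are primitive (each takes the value `1`; `PsiBrandt.isPrimitiveInt_of_apply_eq_one` of the
tree's `PsiBrandtDegreeLawAtEightCert`, imported — desc's local restatement dropped by the typer). -/
theorem certificates_primitive :
    IsPrimitiveInt 3 g96a ∧ IsPrimitiveInt 11 g352a ∧ IsPrimitiveInt 13 g416a ∧ IsPrimitiveInt 29 g928a :=
  ⟨isPrimitiveInt_of_apply_eq_one g96a_certificate.2.2.2.1, isPrimitiveInt_of_apply_eq_one g352a_certificate.2.2.2.1,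
    isPrimitiveInt_of_apply_eq_one g416a_certificate.2.2.2.1, isPrimitiveInt_of_apply_eq_one g928a_certificate.2.2.2.1⟩

/-- `ψ` takes both signs on the elements `≡ 1 (mod 2O)` of reduced norm `5`: the signed Brandt matrix is NOT the plain one
(`Σ ψ = 2·a₅(32a1) = −4` over the twelve such elements, the `M = 1` module being the line of `32a1`). -/
theorem psi32Sign_sum_norm_five :
    ((((hurwitzOfNorm 5).filter fun γ => @decide (InOnePlusTwoO γ) (InOnePlusTwoO.decidable γ)).map psi32Sign).sum = -4) ∧
      ((((hurwitzOfNorm 3).filter fun γ => @decide (InOnePlusTwoO γ) (InOnePlusTwoO.decidable γ)).map psi32Sign).sum = 0) := by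
  constructor <;> decide +kernel

end Summit.BirchSwinnertonDyer.Rank1Residual.ManinAdditive.Psi32Brandt
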